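import Summits.BirchSwinnertonDyer.BirchSwinnertonDyer.Theorems.SylvesterTwoHeegnerIndexCoupledTelescopePairFlip
import Literature.NumberTheory.EllipticCurves.HuShuYin2019.SylvesterPairGoodPlaces
import Summits.BirchSwinnertonDyer.BirchSwinnertonDyer.Theorems.SylvesterTwoHeegnerIndexCoupledTelescopeSelmerAway
import HarnessLib

/-!
# The COUPLED Cassels–Tate telescope, XL: the level-pair FLIP in the HSY orientation of RESIDUE c v3 l.93–98,
# for the CLASS TERMS of the (T-L1) system (crux `UpperOffV0HSYPlus`, stmt-BirchSwinnertonDyer-19804)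

`pairFlip_core_sylvesterTower` (`…CoupledTelescopePairFlip`) in one orientation of the coupled frame of
`exists_coupledFrame` (`ψ_B : E₉ ≃ E_p` with family `ρ`, `ψ_A : E₉ ≃ E_{3p²}` with family `ρ ∘ ρ`, `ρ³ = 1`), exactly
as (T9b) `flip_upper{A,B}_sylvesterTower` specialise (T9)'s core, with the orientation-specific inputs DISCHARGED:
good reduction of `A_K, B_K` at `λ ∋ ℓ` (k-ty1 #11), `N₀` fixing the cube roots (#R-c), and the bottom class Selmer
at `λ` (`kolyvaginClass_cmFrame_cubeSumCurve_{prime,three_mul_sq}_mem_selmerLocalKer` at the bottom level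
`9pm`, `ℓ ∤ 9pm`, the χ-sum `N_b`-fixed by `chiComponent_mem`) (the twin orientation l.87–92 is `…PairFlipUpperA`):
* ★ `pairFlip_upperB_sylvesterTower` — l.93–98: `k • c_B(ℓm) ∈ Sel_λ(B) ↔ k • c_A(m) ∈ T_A(λ)`;
for the class TERMS `c_X(n) = kolyvaginClass X nl hdiv hA_X^{(n)} (ψ_X(Σᵢ ρ_X(tᵢ)(tᵢ • κ⁻¹ ιe_n (D_{l_n} y_n)))) hP_X^{(n)}`
with the level data of `levelData_sylvesterTower` (`…CoupledTelescopeLevelData`) at the two levels.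
Theorems only (no definition / named fact / instance / notation); nothing asserted on 19804; no stub closed;
X12.CMAtTwo NOT proved; BSD not claimed for any curve.  Sources: [GrossLMS1991] §3 (3.5), Prop. 3.7, §4, Prop. 6.2;
[McCallumLMS1991] Prop. 4.4, §4 (4)–(6); [Nekovar2007] Prop. 4.9, 4.13; [HuShuYin2019] §1–§2, §4.1.
`lean search 'pairFlip_upper'` → nothing before this file.
-/

set_option linter.dupNamespace false -- Summits modules are `Summit.<Summit>.<Problem>…` by design
set_option autoImplicit false

noncomputable section

open scoped Classical Pointwise

namespace Summit.BirchSwinnertonDyer.BirchSwinnertonDyer.Theorems.SylvesterTwoCMFlip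

open WeierstrassCurve Field NumberField IsDedekindDomain Finset
open Literature.NumberTheory.EllipticCurves Literature.NumberTheory.GaloisRepresentations
  Literature.NumberTheory.EllipticCurves.ModularForms
  Literature.NumberTheory.EllipticCurves.HuShuYin2019
  Literature.NumberTheory.EllipticCurves.KolyvaginCocycle
  Literature.NumberTheory.EllipticCurves.RingClassField
  Summit.BirchSwinnertonDyer.BirchSwinnertonDyer.Theorems.SylvesterTwoCMData
  Summit.BirchSwinnertonDyer.Rank1Residual.X11b
  Summit.BirchSwinnertonDyer.Rank1Residual.X11b.RingClassTower

variable {K : Type} [Field K] [NumberField K]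
set_option maxHeartbeats 1600000 in
/-- ★ **RESIDUE c v3 l.93–98 for the class TERMS: `k • c_B(ℓm)` is Selmer at `λ ∋ ℓ` iff `k • c_A(m) ∈ T_A(λ)`** — `pairFlip_core_sylvesterTower` in the orientation
`(upper, lower) = (B_K, A_K) = (E_p, E_{3p²})` (upper family `ρ`, lower family `ρ ∘ ρ`), for the levels `Nb = 9pm ⊂ Nt = 9p(ℓm)` with coherent
embeddings and compatible generator lists; the top class built with `N_t`, the bottom class with `N_b` (their
well-formedness = `levelData_sylvesterTower`'s outputs, here hypotheses), every `k : ℤ`.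
[cite: GrossLMS1991, §3 (3.5), Prop. 3.7, Prop. 6.2 (2), §4] [cite: McCallumLMS1991, Prop. 4.4, §4 (4)–(6)]
[cite: HuShuYin2019, §1 p. 4, §2 Prop. 2.4, §4.1] [cite: Nekovar2007, Prop. 4.9, Prop. 4.13 (ii)] -/
theorem pairFlip_upperB_sylvesterTower {ω : K} (hω : ω ^ 2 + ω + 1 = 0) (h2 : Module.finrank ℚ K = 2)
    (ι : K →+* ℂ) [(⟨0, 0, 1, 0, -1⟩ : WeierstrassCurve ℚ).IsElliptic] [(⟨0, 0, 1, 0, -1⟩ : WeierstrassCurve ℚ).IsGloballyMinimal] (hES2 : Nekovar2007.cmPoint_frobeniusCongruence)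
    (Dt : ModularParametrizationData (⟨0, 0, 1, 0, -1⟩ : WeierstrassCurve ℚ) 243)
    {p ℓ m Nb Nt : ℕ} (hp : p.Prime) (hp3 : p % 3 = 1) (hℓ : ℓ.Prime) (hℓ3 : ℓ % 3 = 2) (hℓ2 : ℓ ≠ 2)
    (hm : m ≠ 0) (hm3 : ∀ q ∈ m.primeFactors, q % 3 = 2) (hℓm : ¬ ℓ ∣ m)
    (hNb : 9 * p * m = Nb) (hNt : 9 * p * (ℓ * m) = Nt)
    (hℓA : ¬ ℓ ∣ (cubeSumCurve (3 * (p : ℚ) ^ 2)).conductorNorm ℤ) (hℓdK : ¬ ((ℓ : ℤ) ∣ NumberField.discr K))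
    {M : ℕ} (hM : 1 ≤ M) (nl : ℕ) (hn : nl = 2 ^ M) (hFrobA : FrobEqFrobInfty (cubeSumCurve (3 * (p : ℚ) ^ 2)) K nl ℓ)
    -- the frame transport `E₉(K̄) ≃+ W₀(K̄)`
    (κ : geomPoints ((cubeSumCurve 9).baseChange K) ≃+ geomPoints ((⟨0, 0, 1, 0, -1⟩ : WeierstrassCurve ℚ).baseChange K))
    (hκG : ∀ (g : absoluteGaloisGroup K) (P : geomPoints ((cubeSumCurve 9).baseChange K)), κ (g • P) = g • κ P)
    {a b d : AlgebraicClosure K}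
    (hκ : ∀ {x y : AlgebraicClosure K}
      (h : (((cubeSumCurve 9).baseChange K).baseChange (AlgebraicClosure K)).toAffine.Nonsingular x y),
      ∃ h', κ (.some x y h) = .some (a * x) (b * y + d) h')
    -- the coupled frame (`exists_coupledFrame`)
    {vB vA : AlgebraicClosure K} (hvBc : vB ^ 3 = algebraMap ℚ (AlgebraicClosure K) ((p : ℚ) / 9))
    (hvB : vB ≠ 0) (hvAc : vA ^ 3 = algebraMap ℚ (AlgebraicClosure K) ((p : ℚ) ^ 2 / 3)) (hvA0 : vA ≠ 0)
    (hvB3 : ∀ g : absoluteGaloisGroup K, ((show AlgebraicClosure K ≃ₐ[K] AlgebraicClosure K from g) vB) ^ 3 = vB ^ 3)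
    (hvA3 : ∀ g : absoluteGaloisGroup K, ((show AlgebraicClosure K ≃ₐ[K] AlgebraicClosure K from g) vA) ^ 3 = vA ^ 3)
    {ψB : geomPoints ((cubeSumCurve 9).baseChange K) ≃+ geomPoints ((cubeSumCurve (p : ℚ)).baseChange K)}
    {ψA : geomPoints ((cubeSumCurve 9).baseChange K) ≃+ geomPoints ((cubeSumCurve (3 * (p : ℚ) ^ 2)).baseChange K)}
    (hψB : ∀ {x y : AlgebraicClosure K}
      (h : (((cubeSumCurve 9).baseChange K).baseChange (AlgebraicClosure K)).toAffine.Nonsingular x y),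
      ∃ h', ψB (Affine.Point.some x y h) = Affine.Point.some (vB ^ 2 * x) (vB ^ 3 * y) h')
    (hψA : ∀ {x y : AlgebraicClosure K}
      (h : (((cubeSumCurve 9).baseChange K).baseChange (AlgebraicClosure K)).toAffine.Nonsingular x y),
      ∃ h', ψA (Affine.Point.some x y h) = Affine.Point.some (vA ^ 2 * x) (vA ^ 3 * y) h')
    {ρ : absoluteGaloisGroup K → geomPoints ((cubeSumCurve 9).baseChange K) ≃+ geomPoints ((cubeSumCurve 9).baseChange K)}
    (hρ : ∀ (g : absoluteGaloisGroup K) {x y : AlgebraicClosure K}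
        (h : (((cubeSumCurve 9).baseChange K).baseChange (AlgebraicClosure K)).toAffine.Nonsingular x y),
        ∃ h', ρ g (Affine.Point.some x y h) =
          Affine.Point.some (((show AlgebraicClosure K ≃ₐ[K] AlgebraicClosure K from g) vB / vB) ^ 2 * x) y h')
    (hρρ : ∀ (g : absoluteGaloisGroup K) {x y : AlgebraicClosure K}
        (h : (((cubeSumCurve 9).baseChange K).baseChange (AlgebraicClosure K)).toAffine.Nonsingular x y),
        ∃ h', ρ g (ρ g (Affine.Point.some x y h)) =
          Affine.Point.some (((show AlgebraicClosure K ≃ₐ[K] AlgebraicClosure K from g) vA / vA) ^ 2 * x) y h')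
    (hlawB : ∀ (g : absoluteGaloisGroup K) (P : geomPoints ((cubeSumCurve 9).baseChange K)), g • ψB P = ψB (ρ g (g • P)))
    (hlawA : ∀ (g : absoluteGaloisGroup K) (P : geomPoints ((cubeSumCurve 9).baseChange K)),
        g • ψA P = ψA (ρ g (ρ g (g • P))))
    (hρcomm : ∀ (g h : absoluteGaloisGroup K) (P : geomPoints ((cubeSumCurve 9).baseChange K)), h • ρ g P = ρ g (h • P))
    -- the bottom embedding `K[9p] → K̄`, its fixer, representatives
    (emb₀ : ringClassField K ι (9 * p) →+* AlgebraicClosure K)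
    (N₀ : Subgroup (absoluteGaloisGroup K))
    (hN₀ : ∀ g : absoluteGaloisGroup K, g ∈ N₀ ↔
      ∀ x : ringClassField K ι (9 * p), (show AlgebraicClosure K ≃ₐ[K] AlgebraicClosure K from g) (emb₀ x) = emb₀ x)
    {ιt : Type} [Fintype ιt] (t : ιt → absoluteGaloisGroup K)
    -- the bottom level `K[Nb]`, `Nb = 9pm`
    (hle₀b : ringClassField K ι (9 * p) ≤ ringClassField K ι Nb)
    (emb_b : ringClassField K ι Nb →+* AlgebraicClosure K)
    (hemb_b : ∀ k : K, emb_b (algebraMap K (ringClassField K ι Nb) k) = algebraMap K (AlgebraicClosure K) k)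
    (hcoh₀b : ∀ x : ringClassField K ι (9 * p), emb_b (RingClassField.inclusion ι hle₀b x) = emb₀ x)
    (ιe_b : letI : DecidableEq (ringClassField K ι Nb) := fun a b ↦ Classical.propDecidable (a = b)
      ((⟨0, 0, 1, 0, -1⟩ : WeierstrassCurve ℚ).baseChange (ringClassField K ι Nb)).toAffine.Point →+ geomPoints ((⟨0, 0, 1, 0, -1⟩ : WeierstrassCurve ℚ).baseChange K))
    (hιe_b : ∀ P, ιe_b P = Affine.Point.map (W' := (⟨0, 0, 1, 0, -1⟩ : WeierstrassCurve ℚ)) emb_b.toRatAlgHom P)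
    (N_b : Subgroup (absoluteGaloisGroup K)) [N_b.Normal]
    (hN_b : ∀ g : absoluteGaloisGroup K, g ∈ N_b ↔
      ∀ x : ringClassField K ι Nb, (show AlgebraicClosure K ≃ₐ[K] AlgebraicClosure K from g) (emb_b x) = emb_b x)
    (l_b : List ((ringClassField K ι Nb ≃ₐ[ℚ] ringClassField K ι Nb) × ℕ))
    {y_b : ((⟨0, 0, 1, 0, -1⟩ : WeierstrassCurve ℚ).baseChange (ringClassField K ι Nb)).toAffine.Point}
    (hy_b : Affine.Point.map (W' := (⟨0, 0, 1, 0, -1⟩ : WeierstrassCurve ℚ)) (ringClassField K ι Nb).subtype.toRatAlgHom y_b =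
      Dt.φ (heegnerTau ((m : ℤ) ^ 2 * (81 * ((p : ℤ) ^ 2 + 4 * p + 16)),
        (m : ℤ) * (-(9 * (4 * (p : ℤ) ^ 2 + 17 * p + 72))), 4 * (p : ℤ) ^ 2 + 18 * p + 81)))
    (hPN_b : κ.symm (ιe_b (l_b.foldr (fun c z ↦ KolyvaginOperator.derivOp (pointGalHom (⟨0, 0, 1, 0, -1⟩ : WeierstrassCurve ℚ) (ringClassField K ι Nb)) c.1 c.2 z) y_b)) ∈
      FixedPoints.addSubgroup N_b (geomPoints ((cubeSumCurve 9).baseChange K)))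
    -- the top level `K[Nt]`, `Nt = 9p(ℓm)`, coherent over the bottom one
    (hle_bt : ringClassField K ι Nb ≤ ringClassField K ι Nt)
    (emb_t : ringClassField K ι Nt →+* AlgebraicClosure K)
    (hemb_t : ∀ k : K, emb_t (algebraMap K (ringClassField K ι Nt) k) = algebraMap K (AlgebraicClosure K) k)
    (hcoh_bt : ∀ x : ringClassField K ι Nb, emb_t (RingClassField.inclusion ι hle_bt x) = emb_b x)
    (ιe_t : letI : DecidableEq (ringClassField K ι Nt) := fun a b ↦ Classical.propDecidable (a = b)
      ((⟨0, 0, 1, 0, -1⟩ : WeierstrassCurve ℚ).baseChange (ringClassField K ι Nt)).toAffine.Point →+ geomPoints ((⟨0, 0, 1, 0, -1⟩ : WeierstrassCurve ℚ).baseChange K))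
    (hιe_t : ∀ P, ιe_t P = Affine.Point.map (W' := (⟨0, 0, 1, 0, -1⟩ : WeierstrassCurve ℚ)) emb_t.toRatAlgHom P)
    (N_t : Subgroup (absoluteGaloisGroup K))
    (hN_t : ∀ g : absoluteGaloisGroup K, g ∈ N_t ↔
      ∀ x : ringClassField K ι Nt, (show AlgebraicClosure K ≃ₐ[K] AlgebraicClosure K from g) (emb_t x) = emb_t x)
    {σ : ringClassField K ι Nt ≃ₐ[ℚ] ringClassField K ι Nt}
    (hσ : Subgroup.zpowers σ = ringClassGalOver ι Nt Nb)
    (l_t l_b' : List ((ringClassField K ι Nt ≃ₐ[ℚ] ringClassField K ι Nt) × ℕ))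
    (hperm : l_t.Perm ((σ, ℓ) :: l_b'))
    (hcompat : List.Forall₂ (fun a b ↦ a.2 = b.2 ∧ ∀ x : ringClassField K ι Nb,
      a.1 (RingClassField.inclusion ι hle_bt x) = RingClassField.inclusion ι hle_bt (b.1 x)) l_b' l_b)
    (hc_t : ∀ a ∈ l_t, ∀ b ∈ l_t, Commute a.1 b.1) (hgal : ∀ a ∈ l_t, a.1 ∈ ringClassGal ι Nt)
    {y_t : ((⟨0, 0, 1, 0, -1⟩ : WeierstrassCurve ℚ).baseChange (ringClassField K ι Nt)).toAffine.Point}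
    (hy_t : Affine.Point.map (W' := (⟨0, 0, 1, 0, -1⟩ : WeierstrassCurve ℚ)) (ringClassField K ι Nt).subtype.toRatAlgHom y_t =
      Dt.φ (heegnerTau (((ℓ * m : ℕ) : ℤ) ^ 2 * (81 * ((p : ℤ) ^ 2 + 4 * p + 16)),
        ((ℓ * m : ℕ) : ℤ) * (-(9 * (4 * (p : ℤ) ^ 2 + 17 * p + 72))), 4 * (p : ℤ) ^ 2 + 18 * p + 81)))
    (htr_t : ∑ i ∈ Finset.range (ℓ + 1), pointGalHom (⟨0, 0, 1, 0, -1⟩ : WeierstrassCurve ℚ) (ringClassField K ι Nt) (σ ^ i) y_t = 0)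
    -- the classes' admissibility / invariance inputs (`levelData_sylvesterTower` at the two levels)
    {hdivA : ∀ P : geomPoints ((cubeSumCurve (3 * (p : ℚ) ^ 2)).baseChange K),
      ∃ R : geomPoints ((cubeSumCurve (3 * (p : ℚ) ^ 2)).baseChange K), ((nl : ℕ) : ℤ) • R = P}
    {hdivB : ∀ P : geomPoints ((cubeSumCurve (p : ℚ)).baseChange K),
      ∃ R : geomPoints ((cubeSumCurve (p : ℚ)).baseChange K), ((nl : ℕ) : ℤ) • R = P}
    (hAA : IsAdmissible (absoluteGaloisGroup K)
      ((FixedPoints.addSubgroup N_t (geomPoints ((cubeSumCurve 9).baseChange K))).map ψA.toAddMonoidHom) ((nl : ℕ) : ℤ))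
    (hAB : IsAdmissible (absoluteGaloisGroup K)
      ((FixedPoints.addSubgroup N_t (geomPoints ((cubeSumCurve 9).baseChange K))).map ψB.toAddMonoidHom) ((nl : ℕ) : ℤ))
    (hP₁ : (ψB (∑ i, ρ (t i) (t i • κ.symm (ιe_t
        (l_t.foldr (fun c z ↦ KolyvaginOperator.derivOp (pointGalHom (⟨0, 0, 1, 0, -1⟩ : WeierstrassCurve ℚ) (ringClassField K ι Nt)) c.1 c.2 z) y_t))))) ∈
      invPoints (absoluteGaloisGroup K)
        ((FixedPoints.addSubgroup N_t (geomPoints ((cubeSumCurve 9).baseChange K))).map ψB.toAddMonoidHom) ((nl : ℕ) : ℤ))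
    (hAAb : IsAdmissible (absoluteGaloisGroup K)
      ((FixedPoints.addSubgroup N_b (geomPoints ((cubeSumCurve 9).baseChange K))).map ψA.toAddMonoidHom) ((nl : ℕ) : ℤ))
    (hP₂b : (ψA (∑ i, ρ (t i) (ρ (t i) (t i • κ.symm (ιe_b
        (l_b.foldr (fun c z ↦ KolyvaginOperator.derivOp (pointGalHom (⟨0, 0, 1, 0, -1⟩ : WeierstrassCurve ℚ) (ringClassField K ι Nb)) c.1 c.2 z) y_b)))))) ∈
      invPoints (absoluteGaloisGroup K)
        ((FixedPoints.addSubgroup N_b (geomPoints ((cubeSumCurve 9).baseChange K))).map ψA.toAddMonoidHom) ((nl : ℕ) : ℤ))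
    (v : HeightOneSpectrum (𝓞 K)) (hv : (ℓ : 𝓞 K) ∈ v.asIdeal) (k : ℤ) :
    k • kolyvaginClass ((cubeSumCurve (p : ℚ)).baseChange K) ((nl : ℕ) : ℤ) hdivB hAB
        (ψB (∑ i, ρ (t i) (t i • κ.symm (ιe_t
        (l_t.foldr (fun c z ↦ KolyvaginOperator.derivOp (pointGalHom (⟨0, 0, 1, 0, -1⟩ : WeierstrassCurve ℚ) (ringClassField K ι Nt)) c.1 c.2 z) y_t))))) hP₁ ∈
        selmerLocalKer ((cubeSumCurve (p : ℚ)).baseChange K) (v.adicCompletion K) ((nl : ℕ) : ℤ) ↔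
      k • kolyvaginClass ((cubeSumCurve (3 * (p : ℚ) ^ 2)).baseChange K) ((nl : ℕ) : ℤ) hdivA hAAb
          (ψA (∑ i, ρ (t i) (ρ (t i) (t i • κ.symm (ιe_b
        (l_b.foldr (fun c z ↦ KolyvaginOperator.derivOp (pointGalHom (⟨0, 0, 1, 0, -1⟩ : WeierstrassCurve ℚ) (ringClassField K ι Nb)) c.1 c.2 z) y_b)))))) hP₂b ∈
        ((cubeSumCurve (3 * (p : ℚ) ^ 2)).baseChange K).torsionLocalKer (v.adicCompletion K) ((nl : ℕ) : ℤ) := by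
  subst hNb
  have hK := JZero.isImaginaryQuadratic_of_sq_add_self_add_one hω h2
  have hp0 : p ≠ 0 := hp.ne_zero
  have hp0' : (p : ℚ) ≠ 0 := by exact_mod_cast hp0
  have hp2 : p ≠ 2 := by rintro rfl; norm_num at hp3
  have hℓ3' : ℓ ≠ 3 := by rintro rfl; norm_num at hℓ3
  have hℓp : ¬ ℓ ∣ p := fun h ↦ by
    have := (Nat.prime_dvd_prime_iff_eq hℓ hp).mp h; subst this; omega
  haveI hBell : ((cubeSumCurve (p : ℚ)).baseChange K).IsElliptic := isElliptic_cubeSumCurve_baseChange K hp0'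
  haveI hAell : ((cubeSumCurve (3 * (p : ℚ) ^ 2)).baseChange K).IsElliptic := isElliptic_cubeSumCurve_baseChange K (by positivity)
  haveI hBellQ : (cubeSumCurve (p : ℚ)).IsElliptic := by
    have h := isElliptic_cubeSumCurve_baseChange ℚ hp0'
    rwa [WeierstrassCurve.baseChange, Algebra.algebraMap_self, WeierstrassCurve.map_id] at h
  haveI hAellQ : (cubeSumCurve (3 * (p : ℚ) ^ 2)).IsElliptic := by
    have h := isElliptic_cubeSumCurve_baseChange ℚ (by positivity : (3 * (p : ℚ) ^ 2) ≠ 0)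
    rwa [WeierstrassCurve.baseChange, Algebra.algebraMap_self, WeierstrassCurve.map_id] at h
  have hNb0 : 9 * p * m ≠ 0 := mul_ne_zero (mul_ne_zero (by norm_num) hp0) hm
  -- `N₀` fixes both cube roots; `N_b ≤ N₀`
  have hN₀b := mem_iff_forall_mem_nine_mul ι hle₀b emb₀ emb_b hcoh₀b hN₀
  have hN₀vB : ∀ h ∈ N₀, (show AlgebraicClosure K ≃ₐ[K] AlgebraicClosure K from h) vB = vB := fun h hh ↦
    forall_apply_eq_of_pow_three_eq_div_nine_of_fix_nine_mul hω h2 ι hp0 hm emb_b hemb_b N₀ hN₀b h hh vB hvBc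
  have hN₀vA : ∀ h ∈ N₀, (show AlgebraicClosure K ≃ₐ[K] AlgebraicClosure K from h) vA = vA := fun h hh ↦
    forall_apply_eq_of_pow_three_eq_sq_div_three_of_fix_nine_mul hω h2 ι hp0 hm emb_b hemb_b N₀ hN₀b h hh vA hvAc
  have hNble : N_b ≤ N₀ := fun g hg ↦ (hN₀ g).mpr fun x ↦ by rw [← hcoh₀b]; exact (hN_b g).mp hg _
  -- the place `λ ∋ ℓ` lies off `3`, `p`, `9pm`
  have h3v : ((3 : ℕ) : 𝓞 K) ∉ v.asIdeal := not_natCast_mem_of_prime_ne hℓ Nat.prime_three hℓ3' v hv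
  have hpv : ((p : ℕ) : 𝓞 K) ∉ v.asIdeal := not_natCast_mem_of_prime_ne hℓ hp (fun h ↦ hℓp (h ▸ dvd_rfl)) v hv
  have hmv : ((9 * p * m : ℕ) : 𝓞 K) ∉ v.asIdeal := by
    intro h
    push_cast at h
    rcases v.isPrime.mem_or_mem h with h1 | h2'
    · rcases v.isPrime.mem_or_mem h1 with h9 | hp'
      · have h9' : ((3 : ℕ) : 𝓞 K) * ((3 : ℕ) : 𝓞 K) ∈ v.asIdeal := by push_cast; norm_num; exact h9
        rcases v.isPrime.mem_or_mem h9' with h3 | h3 <;> exact h3v h3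
      · exact hpv (by exact_mod_cast hp')
    · exact SylvesterTwoCoupledTelescope.natCast_not_mem_of_primeFactors hm v
        (fun r hr ↦ not_natCast_mem_of_prime_ne hℓ (Nat.prime_of_mem_primeFactors hr)
          (fun e ↦ hℓm (by rw [e]; exact Nat.dvd_of_mem_primeFactors hr)) v hv)
        (by exact_mod_cast h2')
  have hgoodA := hasGoodReductionAt_cubeSumCurve_three_mul_sq_baseChange (K := K) hp hp2 v h3v hpv
  have hgoodB := hasGoodReductionAt_cubeSumCurve_prime_baseChange (K := K) hp hp2 v h3v hpv
  -- the `ρ ∘ ρ` family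
  have hρρ' : ∀ (g : absoluteGaloisGroup K) {x y : AlgebraicClosure K}
      (h : (((cubeSumCurve 9).baseChange K).baseChange (AlgebraicClosure K)).toAffine.Nonsingular x y),
      ∃ h', (fun g ↦ (ρ g).trans (ρ g)) g (Affine.Point.some x y h) =
        Affine.Point.some (((show AlgebraicClosure K ≃ₐ[K] AlgebraicClosure K from g) vA / vA) ^ 2 * x) y h' := fun g x y h ↦ hρρ g h
  have hρ' : ∀ (g : absoluteGaloisGroup K) (x : geomPoints ((cubeSumCurve 9).baseChange K)),
      (fun g ↦ (ρ g).trans (ρ g)) g x = ρ g (ρ g x) := fun g x ↦ rfl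
  have hlawA' : ∀ (g : absoluteGaloisGroup K) (P : geomPoints ((cubeSumCurve 9).baseChange K)),
      g • ψA P = ψA ((fun g ↦ (ρ g).trans (ρ g)) g (g • P)) := fun g P ↦ hlawA g P
  -- the bottom class is Selmer at `λ` (Gross Prop. 6.2 (1) at the level `9pm ∌ λ`)
  have hQN_b : (∑ i, ρ (t i) (ρ (t i) (t i • κ.symm (ιe_b
      (l_b.foldr (fun c z ↦ KolyvaginOperator.derivOp (pointGalHom (⟨0, 0, 1, 0, -1⟩ : WeierstrassCurve ℚ) (ringClassField K ι (9 * p * m))) c.1 c.2 z) y_b))))) ∈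
      FixedPoints.addSubgroup N_b (geomPoints ((cubeSumCurve 9).baseChange K)) :=
    chiComponent_mem (fun g ↦ ((ρ g).trans (ρ g)).toAddMonoidHom) (fun g _ ha ↦ JZero.smul_mem_fixedPoints _ N_b g ha)
      (fun g _ ha ↦ JZero.rho_mem_fixedPoints _ hω hvB hvB3 hρ N_b g (JZero.rho_mem_fixedPoints _ hω hvB hvB3 hρ N_b g ha)) t hPN_b
  have hsel₂b : kolyvaginClass ((cubeSumCurve (3 * (p : ℚ) ^ 2)).baseChange K) ((nl : ℕ) : ℤ) hdivA hAAb _ hP₂b ∈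
      selmerLocalKer ((cubeSumCurve (3 * (p : ℚ) ^ 2)).baseChange K) (v.adicCompletion K) ((nl : ℕ) : ℤ) :=
    kolyvaginClass_cmFrame_cubeSumCurve_three_mul_sq_mem_selmerLocalKer hK ι hNb0 emb_b hemb_b N_b hN_b hp hp2 hψA
      (fun h hh ↦ hN₀vA h (hNble hh)) hAAb hQN_b hP₂b v h3v hpv hmv
  exact pairFlip_core_sylvesterTower hω h2 ι hES2 Dt hp hp3 hℓ hℓ3 hℓ2 hm hm3 hℓm rfl hNt hℓA hℓdK hM nl hn
    hFrobA κ hκG hκ hvB hvA0 hvB3 hvA3 hψB hψA (ρ := ρ) (ρ' := fun g ↦ (ρ g).trans (ρ g)) hρ hρρ' hρ' hlawA'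
    hρcomm emb₀ N₀ hN₀ hN₀vB hN₀vA t hle₀b emb_b hemb_b hcoh₀b ιe_b hιe_b N_b hN_b l_b hy_b hle_bt emb_t
    hemb_t hcoh_bt ιe_t hιe_t N_t hN_t hσ l_t l_b' hperm hcompat hc_t hgal hy_t htr_t (hdiv₁ := hdivB)
    (hdiv₂ := hdivA) hAB hAA hP₁ hAAb hP₂b v hv hgoodB hgoodA hsel₂b k

end Summit.BirchSwinnertonDyer.BirchSwinnertonDyer.Theorems.SylvesterTwoCMFlip

end
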